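import Mathlib
import HarnessLib
import Summits.Ventures.LatticeQCDFlow.Scoring.SplitChainTours
import Summits.Ventures.LatticeQCDFlow.Scoring.SplitChainFirstRegeneration

/-!
# Tours of the split chain, II: every regeneration time is almost surely finite, and what follows
# the `(j+1)`-th regeneration is a fresh split chain — tours are identically distributed, each
# independent of the path before it

HONEST FRAMING: exact (Metropolis-corrected) sampling algorithms for lattice gauge theory;
figures of merit are autocorrelation/cost numbers at stated couplings and volumes; no
continuum-physics claim.

Venture `LatticeQCDFlow` (cell pub-lqcd), topic `Scoring`; FANOUT row 8 (`s0-cpn-nemc`, GEN-16).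
NEW WORK of the cell, not a published result; no definition is introduced.  Notation of
`Scoring/SplitChainTours.lean` (head count `K_t`, tour `i = {t : K_t = i}`, tour functionals
`S^ψ_i = ∑' u, 1{K_u = i} ψ(x̂_u, x̂_{u+1})`, `{τ_{j+1} = t + 1} = {K_t = j} ∩ {coin_{t+1}}`).  The
random-time regeneration theorem (`Scoring/SplitChainStrongMarkov.lean`) with the weights
`G_t · 1{K_t = j}` is regeneration at `τ_{j+1}`; the summability it needs is the telescoping of the
tour starts; the transport identity turns functionals of tour `j + 1` into functionals of tour `0`
after `τ_{j+1}`.  Results, for the split chain of `κ(x, ·) ≥ ε ν` with `0 < ε < 1` and ANY initial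
law: (i) every `τ_{j+1}` is almost surely finite (induction on `j`: after `τ_{j+1}` the chain is
fresh, and a fresh chain's first tour ends a.s. by `Scoring/SplitChainFirstRegeneration.lean`);
(ii) THE TOUR THEOREM — weighted by any bounded functional of the path before `τ_{j+1}`, the path
from `τ_{j+1}` on is the split chain started afresh from `ν ⊗ δ_true`; (iii) every functional
`Λ(S^{ψ₁}_{j+1}, S^{ψ₂}_{j+1})` of tour `j + 1` (`Λ(0,0) = 0`) has the expectation of
`Λ(S^{ψ₁}_0, S^{ψ₂}_0)` under the fresh split chain: tours `1, 2, …` are identically distributed —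
lengths, sums, squares, products.  Printed counterpart NAMED ONLY: the regenerative decomposition
of a split chain into i.i.d. tours (Athreya–Ney 1978; Nummelin 1978; Meyn–Tweedie 1993 Thm 17.3.1;
Mykland–Tierney–Yu 1995 §2; Hobert–Jones–Presnell–Rosenthal 2002 §2) — nothing is cited as a fact.

## Content

* **`splitChain_tour_regeneration`** — THE TOUR THEOREM: `ε < 1`, any initial law, `G_t` bounded
  measurable with `DependsOn (G t) (Set.Iic t)`, `H` integrable under `P̂_ν̂`:
  `E[∑' t, G_t 1{K_t = j} 1{coin_{t+1}} H(θ_{t+1} X̂)] = E[∑' t, G_t 1{K_t = j} 1{coin_{t+1}}] · E_{P̂_ν̂}[H]`;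
* **`splitChain_tourStart_finite_zero`**, **`splitChain_tourStart_finite`** — `0 < ε < 1`:
  `E[∑' t, 1{K_t = j} 1{coin_{t+1}}] = 1` for every `j` (the `(j+1)`-th regeneration is a.s. finite);
* **`splitChain_tour_identically_distributed`** —
  `E[Λ(S^{ψ₁}_{j+1}, S^{ψ₂}_{j+1})] = E_{P̂_ν̂}[Λ(S^{ψ₁}_0, S^{ψ₂}_0)]` for jointly measurable `ψ₁, ψ₂`,
  measurable `Λ` with `Λ 0 0 = 0`, the right side integrable.

Reading (value-free): from any start, discard the segment before the first regeneration; the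
successive tours after it are copies of the first tour of a fresh run, each independent of what
preceded it — the structure the regenerative estimator and its error bar rest on.  NOT CLAIMED:
joint independence of the whole tour sequence as one random element (the functional / one-tour-
at-a-time form is proved and is what is used); any `ε` of a concrete sampler.
-/

noncomputable section

namespace Summit.Ventures.LatticeQCDFlow.Scoring

open MeasureTheory ProbabilityTheory Filter Finset Preorder Literature.Probability.MarkovChains
open scoped ENNReal

/-! ### Tours of the split chain -/

section Tours

variable {Ω : Type*} [MeasurableSpace Ω]
  {κ : Kernel Ω Ω} [IsMarkovKernel κ] {ν : Measure Ω} [IsProbabilityMeasure ν] {ε : ℝ≥0∞}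
  {hmin : ∀ x {B : Set Ω}, MeasurableSet B → ε * ν B ≤ κ x B}
  (κs : Kernel (Ω × Bool) (Ω × Bool)) [IsMarkovKernel κs]
  (μs : Measure (Ω × Bool)) [IsProbabilityMeasure μs]

/-- **THE TOUR THEOREM (regeneration at the `(j+1)`-th head).**  `ε < 1`, any initial law; `G_t`
bounded measurable with `DependsOn (G t) (Set.Iic t)`; `H` measurable and integrable under the fresh
split chain `P̂_ν̂`.  Then
`E[∑' t, G_t · 1{K_t = j} · 1{coin_{t+1}} · H(θ_{t+1} X̂)] = E[∑' t, G_t · 1{K_t = j} · 1{coin_{t+1}}] · E_{P̂_ν̂}[H]`: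
weighted by any bounded functional of the path before the `(j+1)`-th regeneration time, the path
from that time on is a fresh split chain from `ν ⊗ δ_true`. -/
theorem splitChain_tour_regeneration (hε : ε < 1)
    (hκs : ∀ p, κs p = (ε • ν).map (fun y : Ω => (y, true))
      + ((1 - ε) • Doeblin.residualKernel κ ν ε hmin p.1).map (fun y : Ω => (y, false)))
    (j : ℕ) {G : ℕ → (ℕ → Ω × Bool) → ℝ} (hG : ∀ t, Measurable (G t))
    (hGd : ∀ t, DependsOn (G t) (Set.Iic t)) {C : ℝ} (hC : ∀ t x, |G t x| ≤ C)
    {H : (ℕ → Ω × Bool) → ℝ} (hH : Measurable H)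
    (hHi : Integrable H (Kernel.trajMeasure (X := fun _ : ℕ => Ω × Bool)
      (ν.map (fun y : Ω => (y, true)))
      (fun n : ℕ => κs.comap (fun h : (i : ↥(Finset.Iic n)) → Ω × Bool =>
        h ⟨n, Finset.mem_Iic.2 le_rfl⟩) (measurable_pi_apply _)))) :
    ∫ x, ∑' t, G t x * (if (∑ s ∈ Finset.range t, (if (x (s + 1)).2 then (1 : ℕ) else 0)) = j
          then (1 : ℝ) else 0) * (if (x (t + 1)).2 then (1 : ℝ) else 0) * H (fun n => x (t + 1 + n))
        ∂(Kernel.trajMeasure (X := fun _ : ℕ => Ω × Bool) μs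
          (fun n : ℕ => κs.comap (fun h : (i : ↥(Finset.Iic n)) → Ω × Bool =>
            h ⟨n, Finset.mem_Iic.2 le_rfl⟩) (measurable_pi_apply _)))
      = (∫ x, ∑' t, G t x * (if (∑ s ∈ Finset.range t, (if (x (s + 1)).2 then (1 : ℕ) else 0)) = j
            then (1 : ℝ) else 0) * (if (x (t + 1)).2 then (1 : ℝ) else 0)
          ∂(Kernel.trajMeasure (X := fun _ : ℕ => Ω × Bool) μs
            (fun n : ℕ => κs.comap (fun h : (i : ↥(Finset.Iic n)) → Ω × Bool =>
              h ⟨n, Finset.mem_Iic.2 le_rfl⟩) (measurable_pi_apply _))))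
        * ∫ y, H y ∂(Kernel.trajMeasure (X := fun _ : ℕ => Ω × Bool) (ν.map (fun y : Ω => (y, true)))
          (fun n : ℕ => κs.comap (fun h : (i : ↥(Finset.Iic n)) → Ω × Bool =>
            h ⟨n, Finset.mem_Iic.2 le_rfl⟩) (measurable_pi_apply _))) := by
  set P := Kernel.trajMeasure (X := fun _ : ℕ => Ω × Bool) μs
      (fun n : ℕ => κs.comap (fun h : (i : ↥(Finset.Iic n)) → Ω × Bool =>
        h ⟨n, Finset.mem_Iic.2 le_rfl⟩) (measurable_pi_apply _)) with hP
  have hC0 : 0 ≤ C :=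
    (abs_nonneg _).trans (hC 0 fun _ => Classical.choice (nonempty_of_isProbabilityMeasure μs))
  -- the weights `G_t · 1{K_t = j}`
  have hWm : ∀ t, Measurable fun x : ℕ → Ω × Bool => G t x * (if (∑ s ∈ Finset.range t,
      (if (x (s + 1)).2 then (1 : ℕ) else 0)) = j then (1 : ℝ) else 0) := fun t =>
    (hG t).mul (measurable_headCountIndicator t j)
  have hWd : ∀ t, DependsOn (fun x : ℕ → Ω × Bool => G t x * (if (∑ s ∈ Finset.range t,
      (if (x (s + 1)).2 then (1 : ℕ) else 0)) = j then (1 : ℝ) else 0)) (Set.Iic t) := by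
    intro t x y hxy
    show G t x * _ = G t y * _
    have hK : (∑ s ∈ Finset.range t, (if (x (s + 1)).2 then (1 : ℕ) else 0))
        = ∑ s ∈ Finset.range t, (if (y (s + 1)).2 then (1 : ℕ) else 0) :=
      Finset.sum_congr rfl fun s hs => by
        rw [hxy (s + 1) (Set.mem_Iic.2 (Nat.succ_le_of_lt (Finset.mem_range.1 hs)))]
    rw [hGd t hxy, hK]
  have hWC : ∀ t x, |G t x * (if (∑ s ∈ Finset.range t,
      (if (x (s + 1)).2 then (1 : ℕ) else 0)) = j then (1 : ℝ) else 0)| ≤ C := fun t x => by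
    rw [abs_mul]
    refine (mul_le_of_le_one_right (abs_nonneg _) ?_).trans (hC t x)
    split_ifs <;> simp
  have hsum := summable_integral_tourStart κs μs j hG hC
  have h := splitChain_regeneration_randomTime κs μs (κ := κ) (ν := ν) (hmin := hmin) hε hκs hWm hWd
    hWC hH hHi hsum
  rw [← hP] at h
  rw [h]
  congr 1
  -- `∑' ∫ = ∫ ∑'` for the weights alone
  have hint : ∀ t, Integrable (fun x : ℕ → Ω × Bool => G t x * (if (∑ s ∈ Finset.range t,
      (if (x (s + 1)).2 then (1 : ℕ) else 0)) = j then (1 : ℝ) else 0)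
      * (if (x (t + 1)).2 then (1 : ℝ) else 0)) P := fun t => by
    refine integrable_of_bounded P ((hWm t).mul (measurable_coinHeads (t + 1))) (C := C * 1)
      fun x => ?_
    rw [abs_mul]
    refine mul_le_mul (hWC t x) ?_ (abs_nonneg _) hC0
    split_ifs <;> simp
  refine integral_tsum_of_summable_integral_norm hint ?_
  refine hsum.congr fun t => integral_congr_ae (ae_of_all _ fun x => ?_)
  beta_reduce
  rw [Real.norm_eq_abs, abs_mul (G t x * _)]
  congr 1
  exact (abs_of_nonneg (by split_ifs <;> norm_num)).symm

/-- **Integrability of the random-time regeneration functional**: under the hypotheses of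
`splitChain_regeneration_randomTime`, `x̂ ↦ ∑' t, G_t · 1{coin_{t+1}} · H(θ_{t+1} x̂)` is integrable. -/
theorem splitChain_regeneration_randomTime_integrable (hε : ε < 1)
    (hκs : ∀ p, κs p = (ε • ν).map (fun y : Ω => (y, true))
      + ((1 - ε) • Doeblin.residualKernel κ ν ε hmin p.1).map (fun y : Ω => (y, false)))
    {G : ℕ → (ℕ → Ω × Bool) → ℝ} (hG : ∀ t, Measurable (G t))
    (hGd : ∀ t, DependsOn (G t) (Set.Iic t)) {CG : ℕ → ℝ} (hCG : ∀ t x, |G t x| ≤ CG t)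
    {H : (ℕ → Ω × Bool) → ℝ} (hH : Measurable H)
    (hHi : Integrable H (Kernel.trajMeasure (X := fun _ : ℕ => Ω × Bool)
      (ν.map (fun y : Ω => (y, true)))
      (fun n : ℕ => κs.comap (fun h : (i : ↥(Finset.Iic n)) → Ω × Bool =>
        h ⟨n, Finset.mem_Iic.2 le_rfl⟩) (measurable_pi_apply _))))
    (hsum : Summable fun t : ℕ => ∫ x, |G t x| * (if (x (t + 1)).2 then (1 : ℝ) else 0)
      ∂(Kernel.trajMeasure (X := fun _ : ℕ => Ω × Bool) μs
        (fun n : ℕ => κs.comap (fun h : (i : ↥(Finset.Iic n)) → Ω × Bool =>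
          h ⟨n, Finset.mem_Iic.2 le_rfl⟩) (measurable_pi_apply _)))) :
    Integrable (fun x : ℕ → Ω × Bool => ∑' t, G t x * (if (x (t + 1)).2 then (1 : ℝ) else 0)
        * H (fun n => x (t + 1 + n)))
      (Kernel.trajMeasure (X := fun _ : ℕ => Ω × Bool) μs
        (fun n : ℕ => κs.comap (fun h : (i : ↥(Finset.Iic n)) → Ω × Bool =>
          h ⟨n, Finset.mem_Iic.2 le_rfl⟩) (measurable_pi_apply _))) := by
  set P := Kernel.trajMeasure (X := fun _ : ℕ => Ω × Bool) μs
      (fun n : ℕ => κs.comap (fun h : (i : ↥(Finset.Iic n)) → Ω × Bool =>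
        h ⟨n, Finset.mem_Iic.2 le_rfl⟩) (measurable_pi_apply _)) with hP
  set Pν := Kernel.trajMeasure (X := fun _ : ℕ => Ω × Bool) (ν.map (fun y : Ω => (y, true)))
      (fun n : ℕ => κs.comap (fun h : (i : ↥(Finset.Iic n)) → Ω × Bool =>
        h ⟨n, Finset.mem_Iic.2 le_rfl⟩) (measurable_pi_apply _)) with hPν
  have hIt : ∀ t, Integrable (fun x : ℕ → Ω × Bool =>
      G t x * (if (x (t + 1)).2 then (1 : ℝ) else 0) * H (fun n => x (t + 1 + n))) P := by
    intro t
    have hI := splitChain_integrable_head_shift κs μs (κ := κ) (ν := ν) (hmin := hmin) hε hκs t hHi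
    rw [← hP] at hI
    refine (hI.bdd_mul (c := CG t) (hG t).aestronglyMeasurable
      (ae_of_all _ fun x => by rw [Real.norm_eq_abs]; exact hCG t x)).congr
      (ae_of_all _ fun x => ?_)
    simp only [mul_assoc]
  have habs : ∀ t, ∫ x, ‖G t x * (if (x (t + 1)).2 then (1 : ℝ) else 0)
      * H (fun n => x (t + 1 + n))‖ ∂P
      = (∫ x, |G t x| * (if (x (t + 1)).2 then (1 : ℝ) else 0) ∂P) * ∫ y, |H y| ∂Pν := by
    intro t
    have hGad : DependsOn (fun x => |G t x|) (Set.Iic t) := fun x y hxy => by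
      show |G t x| = |G t y|; rw [hGd t hxy]
    have hCGa : ∀ x, |(fun x => |G t x|) x| ≤ CG t := fun x => by
      show |(|G t x|)| ≤ CG t; rw [abs_abs]; exact hCG t x
    have h := splitChain_regeneration_integral_cond κs μs (κ := κ) (ν := ν) (hmin := hmin) hε hκs t
      (hG t).abs hGad hCGa hH.abs hHi.abs
    rw [← hP, ← hPν] at h
    rw [← h]
    refine integral_congr_ae (ae_of_all _ fun x => ?_)
    beta_reduce
    rw [Real.norm_eq_abs, abs_mul, abs_mul]
    congr 1
    congr 1
    split_ifs <;> simp
  refine integrable_tsum_of_summable_integral_norm P hIt ?_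
  simp_rw [habs]
  exact hsum.mul_right _

/-- **Integrability at the `(j+1)`-th regeneration**: under the hypotheses of
`splitChain_tour_regeneration`, `x̂ ↦ ∑' t, G_t 1{K_t = j} 1{coin_{t+1}} H(θ_{t+1} x̂)` is integrable. -/
theorem splitChain_tour_integrable (hε : ε < 1)
    (hκs : ∀ p, κs p = (ε • ν).map (fun y : Ω => (y, true))
      + ((1 - ε) • Doeblin.residualKernel κ ν ε hmin p.1).map (fun y : Ω => (y, false)))
    (j : ℕ) {G : ℕ → (ℕ → Ω × Bool) → ℝ} (hG : ∀ t, Measurable (G t))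
    (hGd : ∀ t, DependsOn (G t) (Set.Iic t)) {C : ℝ} (hC : ∀ t x, |G t x| ≤ C)
    {H : (ℕ → Ω × Bool) → ℝ} (hH : Measurable H)
    (hHi : Integrable H (Kernel.trajMeasure (X := fun _ : ℕ => Ω × Bool)
      (ν.map (fun y : Ω => (y, true)))
      (fun n : ℕ => κs.comap (fun h : (i : ↥(Finset.Iic n)) → Ω × Bool =>
        h ⟨n, Finset.mem_Iic.2 le_rfl⟩) (measurable_pi_apply _)))) :
    Integrable (fun x : ℕ → Ω × Bool => ∑' t, G t x * (if (∑ s ∈ Finset.range t,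
        (if (x (s + 1)).2 then (1 : ℕ) else 0)) = j then (1 : ℝ) else 0)
        * (if (x (t + 1)).2 then (1 : ℝ) else 0) * H (fun n => x (t + 1 + n)))
      (Kernel.trajMeasure (X := fun _ : ℕ => Ω × Bool) μs
        (fun n : ℕ => κs.comap (fun h : (i : ↥(Finset.Iic n)) → Ω × Bool =>
          h ⟨n, Finset.mem_Iic.2 le_rfl⟩) (measurable_pi_apply _))) := by
  have hWm : ∀ t, Measurable fun x : ℕ → Ω × Bool => G t x * (if (∑ s ∈ Finset.range t,
      (if (x (s + 1)).2 then (1 : ℕ) else 0)) = j then (1 : ℝ) else 0) := fun t =>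
    (hG t).mul (measurable_headCountIndicator t j)
  have hWd : ∀ t, DependsOn (fun x : ℕ → Ω × Bool => G t x * (if (∑ s ∈ Finset.range t,
      (if (x (s + 1)).2 then (1 : ℕ) else 0)) = j then (1 : ℝ) else 0)) (Set.Iic t) := by
    intro t x y hxy
    show G t x * _ = G t y * _
    have hK : (∑ s ∈ Finset.range t, (if (x (s + 1)).2 then (1 : ℕ) else 0))
        = ∑ s ∈ Finset.range t, (if (y (s + 1)).2 then (1 : ℕ) else 0) :=
      Finset.sum_congr rfl fun s hs => by
        rw [hxy (s + 1) (Set.mem_Iic.2 (Nat.succ_le_of_lt (Finset.mem_range.1 hs)))]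
    rw [hGd t hxy, hK]
  have hWC : ∀ t x, |G t x * (if (∑ s ∈ Finset.range t,
      (if (x (s + 1)).2 then (1 : ℕ) else 0)) = j then (1 : ℝ) else 0)| ≤ C := fun t x => by
    rw [abs_mul]
    refine (mul_le_of_le_one_right (abs_nonneg _) ?_).trans (hC t x)
    split_ifs <;> simp
  exact splitChain_regeneration_randomTime_integrable κs μs (κ := κ) (ν := ν) (hmin := hmin) hε
    hκs hWm hWd hWC hH hHi (summable_integral_tourStart κs μs j hG hC)

/-- **THE FIRST TOUR ENDS ALMOST SURELY** (`0 < ε < 1`, any initial law):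
`E[∑' t, 1{K_t = 0} · 1{coin_{t+1}}] = 1`. -/
theorem splitChain_tourStart_finite_zero (hε0 : 0 < ε) (hε : ε < 1)
    (hκs : ∀ p, κs p = (ε • ν).map (fun y : Ω => (y, true))
      + ((1 - ε) • Doeblin.residualKernel κ ν ε hmin p.1).map (fun y : Ω => (y, false))) :
    ∫ x, ∑' t, (if (∑ s ∈ Finset.range t, (if (x (s + 1)).2 then (1 : ℕ) else 0)) = 0
        then (1 : ℝ) else 0) * (if (x (t + 1)).2 then (1 : ℝ) else 0)
        ∂(Kernel.trajMeasure (X := fun _ : ℕ => Ω × Bool) μs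
          (fun n : ℕ => κs.comap (fun h : (i : ↥(Finset.Iic n)) → Ω × Bool =>
            h ⟨n, Finset.mem_Iic.2 le_rfl⟩) (measurable_pi_apply _))) = 1 := by
  have h := splitChain_firstHead_finite κs μs (κ := κ) (ν := ν) (hmin := hmin) hε0 hε hκs 0
    (F := fun _ => (1 : ℝ)) measurable_const (fun _ _ _ => rfl) (CF := 1) (fun _ => by simp)
  simp only [one_mul, Nat.zero_add, integral_const, probReal_univ, one_smul] at h
  simp_rw [headCount_eq_zero_indicator]
  exact h

/-- **EVERY TOUR ENDS ALMOST SURELY** (`0 < ε < 1`, any initial law): for every `j`,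
`E[∑' t, 1{K_t = j} · 1{coin_{t+1}}] = 1` — the `(j+1)`-th regeneration time is a.s. finite. -/
theorem splitChain_tourStart_finite (hε0 : 0 < ε) (hε : ε < 1)
    (hκs : ∀ p, κs p = (ε • ν).map (fun y : Ω => (y, true))
      + ((1 - ε) • Doeblin.residualKernel κ ν ε hmin p.1).map (fun y : Ω => (y, false))) :
    ∀ j : ℕ, ∫ x, ∑' t, (if (∑ s ∈ Finset.range t, (if (x (s + 1)).2 then (1 : ℕ) else 0)) = j
        then (1 : ℝ) else 0) * (if (x (t + 1)).2 then (1 : ℝ) else 0)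
        ∂(Kernel.trajMeasure (X := fun _ : ℕ => Ω × Bool) μs
          (fun n : ℕ => κs.comap (fun h : (i : ↥(Finset.Iic n)) → Ω × Bool =>
            h ⟨n, Finset.mem_Iic.2 le_rfl⟩) (measurable_pi_apply _))) = 1
  | 0 => splitChain_tourStart_finite_zero κs μs (κ := κ) (ν := ν) (hmin := hmin) hε0 hε hκs
  | j + 1 => by
    haveI hνt : IsProbabilityMeasure (ν.map (fun y : Ω => (y, true))) :=
      Measure.isProbabilityMeasure_map (measurable_tagCoin true).aemeasurable
    -- the functional "tour 0 ends" of the shifted path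
    have hψ : Measurable fun pq : (Ω × Bool) × (Ω × Bool) => (if pq.2.2 then (1 : ℝ) else 0) :=
      Measurable.ite ((measurable_snd.comp measurable_snd) (measurableSet_singleton true))
        measurable_const measurable_const
    have hHm := measurable_tourSum (Ω := Ω) (ψ := fun _ q => if q.2 then (1 : ℝ) else 0) hψ 0
    have hHi : Integrable (fun y : ℕ → Ω × Bool => ∑' u, (if (∑ s ∈ Finset.range u,
        (if (y (s + 1)).2 then (1 : ℕ) else 0)) = 0 then (1 : ℝ) else 0)
        * (if (y (u + 1)).2 then (1 : ℝ) else 0))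
        (Kernel.trajMeasure (X := fun _ : ℕ => Ω × Bool) (ν.map (fun y : Ω => (y, true)))
          (fun n : ℕ => κs.comap (fun h : (i : ↥(Finset.Iic n)) → Ω × Bool =>
            h ⟨n, Finset.mem_Iic.2 le_rfl⟩) (measurable_pi_apply _))) :=
      integrable_of_bounded _ hHm (C := 1) fun y => by
        rw [abs_of_nonneg (tourStart_tsum_mem y 0).1]; exact (tourStart_tsum_mem y 0).2
    have key := splitChain_tour_regeneration κs μs (κ := κ) (ν := ν) (hmin := hmin) hε hκs j
      (G := fun _ _ => (1 : ℝ)) (fun _ => measurable_const) (fun _ _ _ _ => rfl) (C := 1)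
      (fun _ _ => by simp) hHm hHi
    simp only [one_mul] at key
    rw [splitChain_tourStart_finite hε0 hε hκs j,
      splitChain_tourStart_finite_zero κs _ (κ := κ) (ν := ν) (hmin := hmin) hε0 hε hκs,
      one_mul] at key
    refine Eq.trans (integral_congr_ae (ae_of_all _ fun x => ?_)) key
    exact tourSum_eq_tsum_tourStart (fun _ q => if q.2 then (1 : ℝ) else 0)
      (fun _ q => if q.2 then (1 : ℝ) else 0) (fun a _ => a) rfl x j

/-- **TOURS ARE IDENTICALLY DISTRIBUTED, EACH INDEPENDENT OF ITS PAST** (functional form):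
`0 < ε < 1`, any initial law, `ψ₁, ψ₂` jointly measurable, `Λ` measurable with `Λ 0 0 = 0` and
`Λ(S^{ψ₁}_0, S^{ψ₂}_0)` integrable under `P̂_ν̂`.  Then for every `j`,
`E[Λ(S^{ψ₁}_{j+1}, S^{ψ₂}_{j+1})] = E_{P̂_ν̂}[Λ(S^{ψ₁}_0, S^{ψ₂}_0)]` — tour `j + 1` of the chain from
any start has the law of tour `0` of the fresh split chain (tour length, tour sums, their squares
and products, …). -/
theorem splitChain_tour_identically_distributed (hε0 : 0 < ε) (hε : ε < 1)
    (hκs : ∀ p, κs p = (ε • ν).map (fun y : Ω => (y, true))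
      + ((1 - ε) • Doeblin.residualKernel κ ν ε hmin p.1).map (fun y : Ω => (y, false)))
    (j : ℕ) {ψ₁ ψ₂ : Ω × Bool → Ω × Bool → ℝ}
    (hψ₁ : Measurable fun pq : (Ω × Bool) × (Ω × Bool) => ψ₁ pq.1 pq.2)
    (hψ₂ : Measurable fun pq : (Ω × Bool) × (Ω × Bool) => ψ₂ pq.1 pq.2)
    {Λ : ℝ → ℝ → ℝ} (hΛ : Λ 0 0 = 0) (hΛm : Measurable fun ab : ℝ × ℝ => Λ ab.1 ab.2)
    (hint : Integrable (fun y : ℕ → Ω × Bool =>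
      Λ (∑' u, (if (∑ s ∈ Finset.range u, (if (y (s + 1)).2 then (1 : ℕ) else 0)) = 0
          then (1 : ℝ) else 0) * ψ₁ (y u) (y (u + 1)))
        (∑' u, (if (∑ s ∈ Finset.range u, (if (y (s + 1)).2 then (1 : ℕ) else 0)) = 0
          then (1 : ℝ) else 0) * ψ₂ (y u) (y (u + 1))))
      (Kernel.trajMeasure (X := fun _ : ℕ => Ω × Bool) (ν.map (fun y : Ω => (y, true)))
        (fun n : ℕ => κs.comap (fun h : (i : ↥(Finset.Iic n)) → Ω × Bool =>
          h ⟨n, Finset.mem_Iic.2 le_rfl⟩) (measurable_pi_apply _)))) :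
    ∫ x, Λ (∑' u, (if (∑ s ∈ Finset.range u, (if (x (s + 1)).2 then (1 : ℕ) else 0)) = j + 1
          then (1 : ℝ) else 0) * ψ₁ (x u) (x (u + 1)))
        (∑' u, (if (∑ s ∈ Finset.range u, (if (x (s + 1)).2 then (1 : ℕ) else 0)) = j + 1
          then (1 : ℝ) else 0) * ψ₂ (x u) (x (u + 1)))
        ∂(Kernel.trajMeasure (X := fun _ : ℕ => Ω × Bool) μs
          (fun n : ℕ => κs.comap (fun h : (i : ↥(Finset.Iic n)) → Ω × Bool =>
            h ⟨n, Finset.mem_Iic.2 le_rfl⟩) (measurable_pi_apply _)))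
      = ∫ y, Λ (∑' u, (if (∑ s ∈ Finset.range u, (if (y (s + 1)).2 then (1 : ℕ) else 0)) = 0
          then (1 : ℝ) else 0) * ψ₁ (y u) (y (u + 1)))
        (∑' u, (if (∑ s ∈ Finset.range u, (if (y (s + 1)).2 then (1 : ℕ) else 0)) = 0
          then (1 : ℝ) else 0) * ψ₂ (y u) (y (u + 1)))
        ∂(Kernel.trajMeasure (X := fun _ : ℕ => Ω × Bool) (ν.map (fun y : Ω => (y, true)))
          (fun n : ℕ => κs.comap (fun h : (i : ↥(Finset.Iic n)) → Ω × Bool =>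
            h ⟨n, Finset.mem_Iic.2 le_rfl⟩) (measurable_pi_apply _))) := by
  have hHm : Measurable fun y : ℕ → Ω × Bool =>
      Λ (∑' u, (if (∑ s ∈ Finset.range u, (if (y (s + 1)).2 then (1 : ℕ) else 0)) = 0
          then (1 : ℝ) else 0) * ψ₁ (y u) (y (u + 1)))
        (∑' u, (if (∑ s ∈ Finset.range u, (if (y (s + 1)).2 then (1 : ℕ) else 0)) = 0
          then (1 : ℝ) else 0) * ψ₂ (y u) (y (u + 1))) :=
    hΛm.comp ((measurable_tourSum hψ₁ 0).prodMk (measurable_tourSum hψ₂ 0))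
  have key := splitChain_tour_regeneration κs μs (κ := κ) (ν := ν) (hmin := hmin) hε hκs j
    (G := fun _ _ => (1 : ℝ)) (fun _ => measurable_const) (fun _ _ _ _ => rfl) (C := 1)
    (fun _ _ => by simp) hHm hint
  simp only [one_mul] at key
  rw [splitChain_tourStart_finite κs μs (κ := κ) (ν := ν) (hmin := hmin) hε0 hε hκs j, one_mul]
    at key
  refine Eq.trans (integral_congr_ae (ae_of_all _ fun x => ?_)) key
  exact tourSum_eq_tsum_tourStart ψ₁ ψ₂ Λ hΛ x j

/-- **Integrability of tour functionals**: with `ψ₁, ψ₂, Λ` as in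
`splitChain_tour_identically_distributed`, `Λ(S^{ψ₁}_{j+1}, S^{ψ₂}_{j+1})` is integrable under the
split chain from any initial law. -/
theorem splitChain_tourFunctional_integrable (hε : ε < 1)
    (hκs : ∀ p, κs p = (ε • ν).map (fun y : Ω => (y, true))
      + ((1 - ε) • Doeblin.residualKernel κ ν ε hmin p.1).map (fun y : Ω => (y, false)))
    (j : ℕ) {ψ₁ ψ₂ : Ω × Bool → Ω × Bool → ℝ}
    (hψ₁ : Measurable fun pq : (Ω × Bool) × (Ω × Bool) => ψ₁ pq.1 pq.2)
    (hψ₂ : Measurable fun pq : (Ω × Bool) × (Ω × Bool) => ψ₂ pq.1 pq.2)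
    {Λ : ℝ → ℝ → ℝ} (hΛ : Λ 0 0 = 0) (hΛm : Measurable fun ab : ℝ × ℝ => Λ ab.1 ab.2)
    (hint : Integrable (fun y : ℕ → Ω × Bool =>
      Λ (∑' u, (if (∑ s ∈ Finset.range u, (if (y (s + 1)).2 then (1 : ℕ) else 0)) = 0
          then (1 : ℝ) else 0) * ψ₁ (y u) (y (u + 1)))
        (∑' u, (if (∑ s ∈ Finset.range u, (if (y (s + 1)).2 then (1 : ℕ) else 0)) = 0
          then (1 : ℝ) else 0) * ψ₂ (y u) (y (u + 1))))
      (Kernel.trajMeasure (X := fun _ : ℕ => Ω × Bool) (ν.map (fun y : Ω => (y, true)))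
        (fun n : ℕ => κs.comap (fun h : (i : ↥(Finset.Iic n)) → Ω × Bool =>
          h ⟨n, Finset.mem_Iic.2 le_rfl⟩) (measurable_pi_apply _)))) :
    Integrable (fun x : ℕ → Ω × Bool =>
      Λ (∑' u, (if (∑ s ∈ Finset.range u, (if (x (s + 1)).2 then (1 : ℕ) else 0)) = j + 1
          then (1 : ℝ) else 0) * ψ₁ (x u) (x (u + 1)))
        (∑' u, (if (∑ s ∈ Finset.range u, (if (x (s + 1)).2 then (1 : ℕ) else 0)) = j + 1
          then (1 : ℝ) else 0) * ψ₂ (x u) (x (u + 1))))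
      (Kernel.trajMeasure (X := fun _ : ℕ => Ω × Bool) μs
        (fun n : ℕ => κs.comap (fun h : (i : ↥(Finset.Iic n)) → Ω × Bool =>
          h ⟨n, Finset.mem_Iic.2 le_rfl⟩) (measurable_pi_apply _))) := by
  have hHm : Measurable fun y : ℕ → Ω × Bool =>
      Λ (∑' u, (if (∑ s ∈ Finset.range u, (if (y (s + 1)).2 then (1 : ℕ) else 0)) = 0
          then (1 : ℝ) else 0) * ψ₁ (y u) (y (u + 1)))
        (∑' u, (if (∑ s ∈ Finset.range u, (if (y (s + 1)).2 then (1 : ℕ) else 0)) = 0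
          then (1 : ℝ) else 0) * ψ₂ (y u) (y (u + 1))) :=
    hΛm.comp ((measurable_tourSum hψ₁ 0).prodMk (measurable_tourSum hψ₂ 0))
  have key := splitChain_tour_integrable κs μs (κ := κ) (ν := ν) (hmin := hmin) hε hκs j
    (G := fun _ _ => (1 : ℝ)) (fun _ => measurable_const) (fun _ _ _ _ => rfl) (C := 1)
    (fun _ _ => by simp) hHm hint
  simp only [one_mul] at key
  refine key.congr (ae_of_all _ fun x => ?_)
  exact (tourSum_eq_tsum_tourStart ψ₁ ψ₂ Λ hΛ x j).symm

end Tours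


end Summit.Ventures.LatticeQCDFlow.Scoring

end
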